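import Summits.CriticalPhenomena.SAWScalingLimit.Theorems.SAWDevelopingMapHexConjectureWindowMassCube
import Summits.CriticalPhenomena.SAWScalingLimit.Theorems.SAWDevelopingMapHexConjectureArcsInWindow
import HarnessLib

/-!
# Crux `HexConjecture` (stmt-CriticalPhenomena-0808), line `root-locality-replaces-loewner` (lead c8):
the CUBE version of the window two-point lower bound is a theorem

Landing target:
`Summits/CriticalPhenomena/SAWScalingLimit/Theorems/SAWDevelopingMapHexConjectureWindowMassCubeMain.lean`
(`--supports stmt-CriticalPhenomena-0808`; registered stub `stub_triDl_cube_le_windowMass`).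

The lever of the line after the c8 reshape is the WINDOW TWO-POINT LOWER BOUND (skeleton statement 2♮♮):
`triDl ⌊R/4⌋ ≤ C · Σ_{d ∈ [θa R, θb R]} Z_{B_R(x)}(s_x → t_{x + d e₀})` — the reference-window boundary two-point mass of the
critical hexagonal-lattice SAW in the upper half-box dominates the Glazman–Manolescu triangle tail LINEARLY.  This file records
that the CUBE version holds unconditionally:

  `triDl(4⌊R/40⌋)³ ≤ Σ_{d ∈ [R/40, R/4]} Z_{B_R(x)}(s_x → t_{x + d e₀})`   for every `R ≥ 40` and every cell `x`
  (`triDl_cube_le_windowMass`),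

composing the two landed halves: Glazman–Manolescu's gluing inequality `triDl(4L)³ ≤ Σ_{glued arcs} x_c^ℓ` (`HV.key_ineq`,
`HexSAWBridgeDecay.lean`) with its left-exiting arcs reflected into the right floor window `[L+1, 9L+1]` and bounded by the coded
floor-arch sums of the strip `S_{9L+1,9L+1}` (`stub_arcsIn_sum_le_windowCoded`, `…ArcsInWindow.lean`), and the transfer of those coded
sums to floor arch masses of the chart preimage `S_x(9L) ⊆ B_R(x)` (`stub_triDl_cube_le_windowMass_of_coded`, `…WindowMassCube.lean`).
What separates the cube from the linear statement is exactly Krachun–Panagiotis 2023, Cor. 3.1 (renewal-time bookkeeping of the same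
construction: `T⁴D_{18T}⁵ ≤ 2¹⁷(Σ_{i≤3T} D_i)⁴ Σ_{k=T}^{21T} G_k`) plus lower regularity of the sequence `D_T`.
Sources: GlazmanManolescu2019 (§4.1, proof of Prop. 1.1), arXiv:2310.17299 (eq. (3), Cor. 3.1), DuminilCopinSmirnov2012 (§3).
-/

noncomputable section

open scoped BigOperators Topology Classical
open Literature.Probability.LatticeModels (HexVertex hexGraph hexCenter Site)
open Literature.Probability.RandomPlanarGeometry
open Literature.Probability.RandomPlanarGeometry.SAW
open Literature.Probability.RandomPlanarGeometry.SAW.HV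

namespace Summit.CriticalPhenomena.SAWScalingLimit.Theorems.HexConjecture.RootLocality

/-- **THE CUBE VERSION OF THE WINDOW TWO-POINT LOWER BOUND.**  For every `R ≥ 40`, every cell `x`, the upper half-box
`B = {v : x₁ ≤ row(v), |c_v − mid s_x| ≤ R}` and the lattice window `S' = {d : R/40 ≤ d ≤ R/4}`:
`triDl(4⌊R/40⌋)³ ≤ Σ_{d ∈ S'} Z_B(s_x → t_{x + d e₀})`, `Z_B(s,t) = Σ_{γ ⊂ B : s → t} x_c^{ℓ(γ)}` — Glazman–Manolescu's three glued
triangle walks form distinct floor arches of the half-box ending in the window.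
[cite: GlazmanManolescu2019, §4.1 (proof of Proposition 1.1); DuminilCopinSmirnov2012, §3] -/
theorem triDl_cube_le_windowMass : ∀ R : ℝ, 40 ≤ R →
    ∀ (x : Site 2) (B : Finset HexVertex) (S' : Finset ℤ),
      (∀ v : HexVertex, v ∈ B ↔ (x 1 ≤ v.1 1 ∧
        dist (hexCenter v) (hexMidpoint s((x - Pi.single 1 1, 1), (x, 0))) ≤ R)) →
      (∀ d : ℤ, d ∈ S' ↔ ((1 / 40 : ℝ) * R ≤ (d : ℝ) ∧ (d : ℝ) ≤ (1 / 4 : ℝ) * R)) →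
      triDl (4 * ⌊R / 40⌋₊) ^ 3 ≤ ∑ d ∈ S', ∑ γ : HexMidEdgeSAW B s((x - Pi.single 1 1, 1), (x, 0))
          s((x + Pi.single 0 d - Pi.single 1 1, 1), (x + Pi.single 0 d, 0)), hexCriticalFugacity ^ γ.length :=
  stub_triDl_cube_le_windowMass_of_coded stub_arcsIn_sum_le_windowCoded

/-- **Registered stub `stub_triDl_cube_le_windowMass`** (crux item stmt-CriticalPhenomena-0808, line `root-locality-replaces-loewner`,
lead c8): the cube version of the window two-point lower bound (`triDl_cube_le_windowMass`).
[cite: GlazmanManolescu2019, §4.1 (proof of Proposition 1.1); DuminilCopinSmirnov2012, §3] -/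
theorem stub_triDl_cube_le_windowMass : ∀ R : ℝ, 40 ≤ R → ∀ (x : Literature.Probability.LatticeModels.Site 2) (B : Finset Literature.Probability.LatticeModels.HexVertex) (S' : Finset ℤ), (∀ v : Literature.Probability.LatticeModels.HexVertex, v ∈ B ↔ (x 1 ≤ v.1 1 ∧ dist (Literature.Probability.LatticeModels.hexCenter v) (Literature.Probability.RandomPlanarGeometry.SAW.hexMidpoint s((x - Pi.single 1 1, 1), (x, 0))) ≤ R)) → (∀ d : ℤ, d ∈ S' ↔ ((1 / 40 : ℝ) * R ≤ (d : ℝ) ∧ (d : ℝ) ≤ (1 / 4 : ℝ) * R)) → Literature.Probability.RandomPlanarGeometry.SAW.HV.triDl (4 * ⌊R / 40⌋₊) ^ 3 ≤ ∑ d ∈ S', ∑ γ : Literature.Probability.RandomPlanarGeometry.SAW.HexMidEdgeSAW B s((x - Pi.single 1 1, 1), (x, 0)) s((x + Pi.single 0 d - Pi.single 1 1, 1), (x + Pi.single 0 d, 0)), Literature.Probability.RandomPlanarGeometry.SAW.hexCriticalFugacity ^ γ.length :=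
  triDl_cube_le_windowMass

end Summit.CriticalPhenomena.SAWScalingLimit.Theorems.HexConjecture.RootLocality

end
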